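import Literature.Computability.AlgebraicComplexity.PlethysmTableauEvaluation
import HarnessLib

/-!
# Rank certificates for highest-weight vectors on the orbit of the padded permanent (format v0-lean)

Topic `Computability/AlgebraicComplexity`; EXECUTABLE definitions (kernel-evaluable) — the Lean
mirror of the certificate format `gct-cert-v0` of the GCT multiplicity-obstruction engine (cell
`pub-gct`, bundle papers/PneNP/gct-obstructions). Honest framing of that cell: rung-1
multiplicity-obstruction search for permanent versus determinant at small `(n, m)`; no claim about
VP ≠ VNP or P ≠ NP is made here or there.

**What a certificate asserts.** Coordinates `(n, m, d, λ)`: `n` = size of the permanent, `m` =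
size of the determinant = degree of the forms, `λ ⊢ d·m`. The padded permanent
`P_{n,m} = z^{m-n} · per_n` is written in `k = n² + 1` variables (`k = n²` when `n = m`):
`x_{i,j} ↦ i·n + j` (`i, j < n`) and the padding variable `z ↦ n²`. A *point* is a `k × k` integer
matrix `g` acting by the tree's column convention `X_v ↦ ∑_w g_{w v} X_w` (`linSubst`,
`LinSubst.lean`), so that `g · P_{n,m}` is the sum over `σ ∈ S_n` of the products of the columns
`g_{•, i n + σ i}` (`i < n`) and `m - n` copies of the column `g_{•, n²}` — a `TableauEval.Point`.
The certificate lists tableau networks `F_0, …` (`TableauEval.Network`, shape `λ`, `d` labels each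
occurring `m` times, alternators on explicit variables `< k` — in the engine's convention
(ENGINE.md §1.4; `check2` README §2; Dörfler–Ikenmeyer–Panova 2020 §5) the alternator of a column
of height `h` sits on the variables `0, …, h-1`, and then `TableauEval.eval` is exactly the
engine's integer normalisation `N_T = (m!)^d f_T` of the tableau covariant), points `g_0, …`,
word-size moduli `p`, an `r × r` minor (rows = networks, columns = points), the engine's claimed
entries mod `p`, and the det-side bound `sk` it was compared with. `Cert.verify` RECOMPUTES every entry
`F_i(g_j · P_{n,m}) mod p` with `TableauEval.evalC` (the column-bijection form of the engine's
defining formula, an implementation independent of the engine's `hwv`/`evalp`/`check2` code), compares with the claimed entries, and checks that the minor's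
determinant is nonzero mod each listed `p` (Laplace expansion `detL`), and that `sk < r`, `0 < m`,
`n ≤ m`, `ℓ(λ) ≤ m²`. The points need not be invertible (singular `g` give points of the orbit
closure, which is all the lower bound needs).

**What the kernel then knows** is exactly arithmetic: `r` explicitly given integer-valued
functions take, at `r` explicitly given points `g · P_{n,m}` (`g` an integer matrix), values whose
`r × r` determinant is nonzero (nonzero mod `p` ⇒ nonzero in `ℤ`, `TableauEval.evalC` and `detL`
commuting with ring maps). That these functions are highest-weight vectors of weight `λ^*` for
`GL_{m²}` in the tree's convention (`coordRep`, `highestWeightSpace`; this involves reversing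
the variable order, the tree's Borel being upper triangular for the contragredient action), hence
`r ≤ mult_{λ^*} ℂ[Δ(z^{m-n} per_n)]`, and that `mult_{λ^*} ℂ[Δ(det_m)] ≤ sk`, are NOT checked here:
the first is the glue file's theorem/hypothesis structure, the second a two-engine computed number
of the cell (BLMW 2011 Prop. 5.2.1: the orbit of `det_m` has multiplicities the symmetric
rectangular Kronecker coefficients). No theorem about representations is stated in this file.

Contents: §1 the padded-permanent point of a matrix; §2 `Cert`, `Cert.entry`, `Cert.minor`,
`Cert.verify`; §3 a toy certificate `toyCert` at `(n, m, d, λ) = (2, 2, 2, (2,2))` (one network —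
the `2 × 2` Gram minor of a quadratic form on the last two coordinates —, one point, moduli
`101, 103`, value `-74 ≡ 27, 29`) with `toyCert_verify : toyCert.verify = true` by `decide +kernel`
(no `native_decide` anywhere). Source of the evaluation formula: [DorflerIkenmeyerPanova2020, §5];
everything else is bookkeeping [folklore].
-/

namespace Literature.Computability.AlgebraicComplexity

namespace TableauEval

/-! ## §1 The padded permanent after a linear substitution, as a sum of products of linear forms -/

section PointOfMatrix

variable {R : Type*} [CommRing R]

/-- Column `v` of a matrix given by rows (missing entries read as `0`). [folklore] -/
def colOf (g : List (List R)) (v : ℕ) : List R := g.map fun row => row.getD v 0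

/-- All permutations of `[0, …, n-1]` (signs dropped). [folklore] -/
def permsOf (n : ℕ) : List (List ℕ) := (permsSign (List.range n)).map fun q => q.2

/-- **The point `g · (z^{m-n} per_n)`** as a sum of `n!` products of `m` linear forms: for
`σ ∈ S_n` the forms are the columns `i·n + σ i` of `g` (`i < n`) followed by `m - n` copies of
column `n²` (the padding variable `z`; absent when `n = m`). Variables of `P_{n,m}`:
`x_{i,j} ↦ i n + j`, `z ↦ n²`; action `X_v ↦ ∑_w g_{w v} X_w`. [folklore] -/
def paddedPermPoint (n m : ℕ) (g : List (List R)) : Point R :=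
  ⟨(permsOf n).map fun σ =>
    (1, ((List.range n).map fun i => colOf g (i * n + σ.getD i 0)) ++
      List.replicate (m - n) (colOf g (n * n)))⟩

/-- Entrywise image of an integer matrix in `R`. [folklore] -/
def matCast (g : List (List ℤ)) : List (List R) := g.map fun row => row.map fun a : ℤ => (Int.cast a : R)

/-- Alternating sum `a₀ - a₁ + a₂ - ⋯` of a list. [folklore] -/
def altSum : List R → R
  | [] => 0
  | a :: l => a - altSum l

/-- Determinant of a square matrix given by rows, by Laplace expansion along the first row with
fuel (the number of rows); entries read with `getD · 0`. Used for the certificate's minor and for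
the invertibility of the points; it agrees with Mathlib's `Matrix.det` on `List.ofFn` matrices
(`detL_ofFn`, proofs file), via `Matrix.det_succ_row_zero`. [folklore] -/
def detL : ℕ → List (List R) → R
  | 0, _ => 1
  | _ + 1, [] => 1
  | f + 1, row :: rest =>
    altSum ((List.range row.length).map fun j =>
      row.getD j 0 * detL f (rest.map fun r => r.eraseIdx j))

end PointOfMatrix

/-! ## §2 Certificates -/

/-- **Certificate, format v0-lean** (mirror of the engine's `gct-cert-v0`; see the module
docstring for the meaning of every field). `claimed` holds, for each modulus in `primes` (same
order), the `r × r` table of the engine's values of the minor's entries mod that modulus.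
[folklore] -/
structure Cert where
  /-- size of the permanent -/
  n : ℕ
  /-- size of the determinant = degree of the forms -/
  m : ℕ
  /-- degree of the highest-weight vectors as polynomial functions on forms -/
  d : ℕ
  /-- the partition `λ ⊢ d·m`, weakly decreasing, no zeros -/
  lam : List ℕ
  /-- the tableau networks (highest-weight vector construction data) -/
  hwvs : List Network
  /-- the points: `k × k` integer matrices, `k = n² + [n < m]` -/
  points : List (List (List ℤ))
  /-- the moduli (word-size primes in practice; primality is not used) -/
  primes : List ℕ
  /-- rows of the minor: indices into `hwvs` -/
  rows : List ℕ
  /-- columns of the minor: indices into `points` -/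
  cols : List ℕ
  /-- claimed entries: `claimed[π][a][b] = F_{rows a}(g_{cols b} · P) mod primes[π]` -/
  claimed : List (List (List ℕ))
  /-- the det-side upper bound the engine compared the rank with (data only) -/
  sk : ℕ

namespace Cert

/-- Number of variables `k = n² + 1` (`n²` if `n = m`). [folklore] -/
def k (c : Cert) : ℕ := c.n * c.n + if c.n < c.m then 1 else 0

/-- The rank being certified: the size of the minor. [folklore] -/
def r (c : Cert) : ℕ := c.rows.length

/-- The `j`-th point reduced mod `p`. [folklore] -/
def pointMod (c : Cert) (p : ℕ) (j : ℕ) : Point (ZMod p) :=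
  paddedPermPoint c.n c.m (matCast (c.points.getD j []))

/-- The recomputed entry `F_i(g_j · P_{n,m}) mod p` (column-bijection evaluator `evalC`). [folklore] -/
def entry (c : Cert) (p : ℕ) (i j : ℕ) : ZMod p := evalC (c.pointMod p j) (c.hwvs.getD i ⟨0, 0, []⟩)

/-- The recomputed minor mod `p` (rows `rows`, columns `cols`). [folklore] -/
def minor (c : Cert) (p : ℕ) : List (List (ZMod p)) :=
  c.rows.map fun i => c.cols.map fun j => c.entry p i j

/-- Structural well-formedness: `0 < m`, `n ≤ m`, `ℓ(λ) ≤ m²`, `λ ⊢ m·d` weakly decreasing and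
positive; every network passes
`Network.check`, has `d` labels, `m` boxes per label, shape `λ` and alternator variables `< k`;
every point is `k × k`; the minor is square with distinct in-range indices; one claimed table per
modulus; moduli `≥ 2`; `sk < r`. [folklore] -/
def structural (c : Cert) : Bool :=
  decide (0 < c.m) && decide (c.n ≤ c.m) && decide (c.lam.length ≤ c.m * c.m)
  && (c.lam.sum == c.m * c.d) && (c.lam.all fun a => 0 < a)
  && (List.zipWith (fun a b => decide (b ≤ a)) c.lam c.lam.tail).all id
  && (c.hwvs.all fun N => N.check && N.nlabels == c.d && N.perLabel == c.m && N.shape == c.lam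
        && N.cols.all fun col => col.vars.all fun v => v < c.k)
  && (c.points.all fun g => g.length == c.k && g.all fun row => row.length == c.k)
  && (c.rows.length == c.cols.length) && decide c.rows.Nodup && decide c.cols.Nodup
  && (c.rows.all fun i => i < c.hwvs.length) && (c.cols.all fun j => j < c.points.length)
  && (c.claimed.length == c.primes.length) && (c.primes.all fun p => 2 ≤ p)
  && decide (c.sk < c.r)

/-- The arithmetic checks modulo the `π`-th modulus `p`: recomputed entries agree with the
claimed ones and the minor's determinant (`detL`, Laplace, `r!` terms — fine for the small ranks
in scope) is nonzero. Points are NOT checked for invertibility: the glue works with the orbit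
CLOSURE, which contains `g · P` for every matrix `g` over an infinite field
(`endOrbit_subset_orbitClosure_holds`). [folklore] -/
def arith (c : Cert) (π : ℕ) (p : ℕ) : Bool :=
  let M := c.minor p
  let cl := c.claimed.getD π []
  (List.zipWith (fun row crow => List.zipWith (fun (x : ZMod p) (y : ℕ) => decide (x = (y : ZMod p)))
      row crow |>.all id) M cl).all id
  && (cl.length == c.r) && (cl.all fun crow => crow.length == c.r)
  && decide (detL c.r M ≠ 0)

/-- Arithmetic checks for all listed moduli. [folklore] -/
def arithAll (c : Cert) : List ℕ → ℕ → Bool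
  | [], _ => true
  | p :: ps, π => c.arith π p && c.arithAll ps (π + 1)

/-- **The verifier**: structural checks and, for every listed modulus, the arithmetic checks.
[folklore] -/
def verify (c : Cert) : Bool := c.structural && !c.primes.isEmpty && c.arithAll c.primes 0

end Cert

/-! ## §3 A toy certificate, checked by the kernel -/

/-- Toy certificate at `(n, m, d, λ) = (2, 2, 2, (2,2))`: `k = 4` variables
`x₀₀, x₀₁, x₁₀, x₁₁ ↦ 0, 1, 2, 3`; one network with two columns of height `2`, both alternating
over the first two variables `0, 1` (the engine's convention), labels `0` over `1` in each column
(the semistandard tableau `1 1 / 2 2` of the engine, labels shifted to start at `0`; as a function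
of a quadratic form it is `8 ×` the `2 × 2` Gram minor on the coordinates `0, 1`); one point `g`;
moduli `101, 103`; the value is `-74 ≡ 27 (101) ≡ 29 (103)` (reproduced independently by the
cell's `check2` evaluators `eval_naive`/`eval_dp` and equal to hwv's frozen example polynomial
`8 c₂₀ c₀₂ - 2 c₁₁²` at `c₂₀ = 1, c₀₂ = 3, c₁₁ = 7`); `sk = 0 < r = 1`. Illustrative only (`per₂`
versus `det₂` carries no obstruction).
[folklore] -/
def toyCert : Cert where
  n := 2
  m := 2
  d := 2
  lam := [2, 2]
  hwvs := [⟨2, 2, [⟨[0, 1], [0, 1]⟩, ⟨[0, 1], [0, 1]⟩]⟩]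
  points := [[[1, 2, 0, 1], [0, 1, 3, 1], [2, 0, 1, 1], [1, 1, 1, 2]]]
  primes := [101, 103]
  rows := [0]
  cols := [0]
  claimed := [[[27]], [[29]]]
  sk := 0

/-- The toy certificate passes the verifier (kernel evaluation, `decide +kernel`). [folklore] -/
theorem toyCert_verify : toyCert.verify = true := by
  decide +kernel

end TableauEval

end Literature.Computability.AlgebraicComplexity
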